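import Mathlib
import Summits.Ventures.PercRepro2.HCov
import Summits.Ventures.PercRepro2.HCovSwap
import Summits.Ventures.PercRepro2.TypeRB

/-!
# Corollary of (TYPE-RB): the type-level mean field of (HCOV) is nonnegative (blind cell
PercRepro2, typer-1; mine-a g3 MINE-A.md §19 COROLLARY; lead g11 14:30:17Z "YES to the corollary
G_{σ(σ₃)} ≥ 0")

`G_{σ(σ₃)} = Cov_μ(E[σ_b | σ₃], E[F | σ₃]) = (φ_L − φ_N) Cov_μ(σ_b, 1_L) + (φ_H − φ_N) Cov_μ(σ_b, 1_H)`
with `φ_L − φ_N = 2(m_H^N − m_H^L) ≥ 0` (fact (c)), `φ_H − φ_N = 2(m_L^H − m_L^N) ≤ 0` (fact (d′)),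
`Cov_μ(σ_b, 1_L) ≥ 0` ((a) + (a′)) and `Cov_μ(σ_b, 1_H) ≤ 0` ((b) + (b′)). **`meanField_cleared_nonneg`**
is this statement multiplied by `P(Q)² P(L) P(H) P(N) / 2` (no positivity assumptions); mine-a's
identity expressing `Cov_μ(E[σ_b | σ₃], E[F | σ₃])` through the four covariances is the paper step
(exact on 7,560 instances) and is not restated here.
-/
/-! ## Corollary: the type-level mean field of (HCOV) is nonnegative -/

namespace Summit.Ventures.PercRepro2

namespace TypeRB

open CovForm SideBridge

open scoped Classical

variable {V : Type*} {E : Type*} [Fintype E] [DecidableEq E] [Fintype V] [DecidableEq V]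
  {R : Type*} [Field R] [LinearOrder R] [IsStrictOrderedRing R]

section MeanField

variable (p : E → R) (ends : E → Sym2 V) (o a₁ a₂ a₃ b : V)

/-- **(a′)** `P(Q) P(L, bH) ≤ P(L) P(Q, bH)` (different clusters: `bH` of `C(a₂)`, `a₃ ∈ C(a₁)`). -/
lemma fact_a' (hp : IsProbVec p) :
    prob p (TEvent ends a₂ a₁ a₃ ∩ connEvent ends a₂ b) * prob p (avoidAll ends a₂ {a₁}) ≤
      prob p (TEvent ends a₂ a₁ a₃) * prob p (avoidAll ends a₂ {a₁} ∩ connEvent ends a₂ b) := by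
  have h := bhk_cross_cluster p hp ends a₁ a₂ (isUpperSet_mem_setOf a₃) (isUpperSet_mem_setOf b)
  rw [← connEvent_eq_clusterInEvent, ← connEvent_eq_clusterInEvent, compl_conn_eq_avoidAll] at h
  rw [L_eq]
  have e1 : connEvent ends a₁ a₃ ∩ connEvent ends a₂ b ∩ avoidAll ends a₂ {a₁} =
      avoidAll ends a₂ {a₁} ∩ connEvent ends a₁ a₃ ∩ connEvent ends a₂ b := by
    ext ω; simp only [Set.mem_inter_iff]; tauto
  have e2 : connEvent ends a₁ a₃ ∩ avoidAll ends a₂ {a₁} =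
      avoidAll ends a₂ {a₁} ∩ connEvent ends a₁ a₃ := Set.inter_comm _ _
  have e3 : connEvent ends a₂ b ∩ avoidAll ends a₂ {a₁} =
      avoidAll ends a₂ {a₁} ∩ connEvent ends a₂ b := Set.inter_comm _ _
  rw [e1, e2, e3] at h
  linarith [h]

/-- **(b′)** `P(H) P(Q, bH) ≤ P(H, bH) P(Q)` (same cluster `C(a₂)`: `a₃, b ∈ C(a₂)`). -/
lemma fact_b' (hp : IsProbVec p) :
    prob p (TEvent ends a₁ a₂ a₃) * prob p (avoidAll ends a₂ {a₁} ∩ connEvent ends a₂ b) ≤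
      prob p (TEvent ends a₁ a₂ a₃ ∩ connEvent ends a₂ b) * prob p (avoidAll ends a₂ {a₁}) := by
  have h := bhk_same_cluster_events p hp ends a₂ a₁ (isUpperSet_mem_setOf a₃) (isUpperSet_mem_setOf b)
  rw [← connEvent_eq_clusterInEvent, ← connEvent_eq_clusterInEvent, compl_conn_eq_avoidAll,
    avoidAll_root_swap] at h
  rw [H_eq]
  have e1 : connEvent ends a₂ a₃ ∩ avoidAll ends a₂ {a₁} =
      avoidAll ends a₂ {a₁} ∩ connEvent ends a₂ a₃ := Set.inter_comm _ _
  have e2 : connEvent ends a₂ b ∩ avoidAll ends a₂ {a₁} =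
      avoidAll ends a₂ {a₁} ∩ connEvent ends a₂ b := Set.inter_comm _ _
  have e3 : connEvent ends a₂ a₃ ∩ connEvent ends a₂ b ∩ avoidAll ends a₂ {a₁} =
      avoidAll ends a₂ {a₁} ∩ connEvent ends a₂ a₃ ∩ connEvent ends a₂ b := by
    ext ω; simp only [Set.mem_inter_iff]; tauto
  rw [e1, e2, e3] at h
  exact h

/-- The signed covariance `P(Q)² Cov_μ(σ_b, 1_τ)` for `τ = L`: `c_L^σ ≥ 0`. -/
lemma covSigma_L_nonneg (hp : IsProbVec p) :
    0 ≤ prob p (avoidAll ends a₂ {a₁}) *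
        (prob p (TEvent ends a₂ a₁ a₃ ∩ connEvent ends a₁ b) -
          prob p (TEvent ends a₂ a₁ a₃ ∩ connEvent ends a₂ b)) -
      prob p (TEvent ends a₂ a₁ a₃) *
        (prob p (avoidAll ends a₂ {a₁} ∩ connEvent ends a₁ b) -
          prob p (avoidAll ends a₂ {a₁} ∩ connEvent ends a₂ b)) := by
  have ha := fact_a p ends a₁ a₂ a₃ b hp
  have ha' := fact_a' p ends a₁ a₂ a₃ b hp
  nlinarith [ha, ha']

/-- The signed covariance for `τ = H`: `c_H^σ ≤ 0`. -/
lemma covSigma_H_nonpos (hp : IsProbVec p) :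
    prob p (avoidAll ends a₂ {a₁}) *
        (prob p (TEvent ends a₁ a₂ a₃ ∩ connEvent ends a₁ b) -
          prob p (TEvent ends a₁ a₂ a₃ ∩ connEvent ends a₂ b)) -
      prob p (TEvent ends a₁ a₂ a₃) *
        (prob p (avoidAll ends a₂ {a₁} ∩ connEvent ends a₁ b) -
          prob p (avoidAll ends a₂ {a₁} ∩ connEvent ends a₂ b)) ≤ 0 := by
  have hb := fact_b p ends a₁ a₂ a₃ b hp
  have hb' := fact_b' p ends a₁ a₂ a₃ b hp
  nlinarith [hb, hb']

/-- **COROLLARY (mine-a §19), cleared form**: the type-level mean field of (HCOV),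
`G_{σ(σ₃)} = Cov_μ(E[σ_b | σ₃], E[F | σ₃]) = (φ_L − φ_N) Cov_μ(σ_b, 1_L) + (φ_H − φ_N) Cov_μ(σ_b, 1_H)`,
is nonnegative: multiplied by `P(Q)² P(L) P(H) P(N) / 2`, it is
`[P(N,oH) P(L) − P(L,oH) P(N)] P(H) c_L^σ + [P(H,oL) P(N) − P(N,oL) P(H)] P(L) c_H^σ ≥ 0`
(both products are nonnegative: (c) with (a)+(a′), and (d′) with (b)+(b′)). -/
theorem meanField_cleared_nonneg (hp : IsProbVec p) :
    0 ≤ (prob p (PDEvent ends a₁ a₂ a₃ ∩ connEvent ends a₂ o) * prob p (TEvent ends a₂ a₁ a₃) -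
          prob p (TEvent ends a₂ a₁ a₃ ∩ connEvent ends a₂ o) * prob p (PDEvent ends a₁ a₂ a₃)) *
        prob p (TEvent ends a₁ a₂ a₃) *
        (prob p (avoidAll ends a₂ {a₁}) *
            (prob p (TEvent ends a₂ a₁ a₃ ∩ connEvent ends a₁ b) -
              prob p (TEvent ends a₂ a₁ a₃ ∩ connEvent ends a₂ b)) -
          prob p (TEvent ends a₂ a₁ a₃) *
            (prob p (avoidAll ends a₂ {a₁} ∩ connEvent ends a₁ b) -
              prob p (avoidAll ends a₂ {a₁} ∩ connEvent ends a₂ b))) +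
      (prob p (TEvent ends a₁ a₂ a₃ ∩ connEvent ends a₁ o) * prob p (PDEvent ends a₁ a₂ a₃) -
          prob p (PDEvent ends a₁ a₂ a₃ ∩ connEvent ends a₁ o) * prob p (TEvent ends a₁ a₂ a₃)) *
        prob p (TEvent ends a₂ a₁ a₃) *
        (prob p (avoidAll ends a₂ {a₁}) *
            (prob p (TEvent ends a₁ a₂ a₃ ∩ connEvent ends a₁ b) -
              prob p (TEvent ends a₁ a₂ a₃ ∩ connEvent ends a₂ b)) -
          prob p (TEvent ends a₁ a₂ a₃) *
            (prob p (avoidAll ends a₂ {a₁} ∩ connEvent ends a₁ b) -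
              prob p (avoidAll ends a₂ {a₁} ∩ connEvent ends a₂ b))) := by
  have hc := fact_c p ends o a₁ a₂ a₃ hp
  have hd := fact_d' p ends o a₁ a₂ a₃ hp
  have hL := prob_nonneg hp (TEvent ends a₂ a₁ a₃)
  have hH := prob_nonneg hp (TEvent ends a₁ a₂ a₃)
  have hcL := covSigma_L_nonneg p ends a₁ a₂ a₃ b hp
  have hcH := covSigma_H_nonpos p ends a₁ a₂ a₃ b hp
  have hW1 : 0 ≤ prob p (PDEvent ends a₁ a₂ a₃ ∩ connEvent ends a₂ o) * prob p (TEvent ends a₂ a₁ a₃) -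
      prob p (TEvent ends a₂ a₁ a₃ ∩ connEvent ends a₂ o) * prob p (PDEvent ends a₁ a₂ a₃) := by
    linarith [hc]
  have hW2 : prob p (TEvent ends a₁ a₂ a₃ ∩ connEvent ends a₁ o) * prob p (PDEvent ends a₁ a₂ a₃) -
      prob p (PDEvent ends a₁ a₂ a₃ ∩ connEvent ends a₁ o) * prob p (TEvent ends a₁ a₂ a₃) ≤ 0 := by
    linarith [hd]
  have h1 := mul_nonneg (mul_nonneg hW1 hH) hcL
  have h2 := mul_nonneg_of_nonpos_of_nonpos (mul_nonpos_of_nonpos_of_nonneg hW2 hL) hcH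
  linarith [h1, h2]

end MeanField

end TypeRB

end Summit.Ventures.PercRepro2
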